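import Summits.ValiantsHypothesis.ValiantsHypothesis.Theorems.KPlusLogSqLawTropicalBThresholdNormalForm
import Summits.ValiantsHypothesis.ValiantsHypothesis.Theorems.KPlusLogSqLawTropicalBStaticPadding
import Summits.ValiantsHypothesis.ValiantsHypothesis.Theorems.KPlusLogSqLawTropicalBShadowCap

/-!
# Route «KPlusLogSqLaw», crux `TropicalB` (stmt-ValiantsHypothesis-19771) — the `B`-UNIFORM linear-exponent boundary vertex law
# implies a `K`-free quasi-polynomial cap on all static designs, the census rows, and `TropicalB`

HONEST FRAMING.  Helper toward the registered stubs `stub_tropThin` / `stub_tropFat` of `Cruxes/TropicalB/Lines/birth.lean`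
(crux `Summit.ValiantsHypothesis.ValiantsHypothesis.Theses.KPlusLogSqLaw.TropicalB`, item `stmt-ValiantsHypothesis-19771`, route
`KPlusLogSqLaw`; cell `pub-symmetroid`, seat val-sym-trop-p1 g15, 2026-08-28; `--supports … --as helper`).  COROLLARIES of the threshold
normal form (`…TropicalBThresholdNormalForm.card_dominant_le_of_code` with the code of `…TropicalBThresholdCodes.exists_injective_code`):
IMPLICATIONS from the `B`-UNIFORM boundary vertex law
`∃ C c, ∀ B m K π ρ lab d v ε, IsBoundaryDesign π ρ lab ε → #Dom ≤ C·(m+1)^(c·B)` (a HYPOTHESIS, unfolded inline, NOT claimed;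
for each fixed `B` it is `BoundarySector.BoundaryVertexLaw B (c·B)` of p447010 with a `B`-independent constant — the «in-window form»
named there).
Nothing here bounds `TropicalB` in its window or bears on `WeakLifting`, DoorA26 / DoorA34, `MatrixDescartes`
(stmt-ValiantsHypothesis-18050) or VP ≠ VNP.

* `card_dominant_static_le_of_uniform` — every STATIC design of format `(2^L, K)` has `≤ C·(2^L+1)^(3cL)` dominant terms: a `K`-FREE
  quasi-polynomial cap on all integer parametric-assignment designs (so the uniform law is at least as strong as the small side of
  Hrubeš–Yehudayoff's Open Problem 1 in design currency — a CALIBRATION of the boundary programme: it is a sector only at FIXED `B`);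
* `tropRootLawAtStatic_pow_of_uniform`, `tropRootLawAtStatic_of_uniform` (size padding `tropRootLawAtStatic_of_le_size`),
  `tropRootLawAt_of_uniform` (static ports `tropRootLawAt_of_static_ports_le`, val-sym-trop-p4) — the census rows;
* `tropicalB_of_uniformBoundaryVertexLaw : (uniform law) → TropicalB`, with the exponent arithmetic `budget_le_two_pow`, `logprod_le`
  (using `log_two_mul_lt`, `sq_add_add_one_le`, `exists_logsq_le_add` of `…TropicalBShadowCap`).
[this cell]
-/

set_option linter.dupNamespace false
set_option autoImplicit false

namespace Summit.ValiantsHypothesis.ValiantsHypothesis.Theorems.KPlusLogSqLaw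

namespace BoundarySector

open Summit.ValiantsHypothesis.ValiantsHypothesis.Theorems.MatrixDescartes.Negative
open Summit.ValiantsHypothesis.ValiantsHypothesis.Theorems.LacunarySymmetroidMatrixDescartes
open Summit.ValiantsHypothesis.ValiantsHypothesis.Theorems.LacunarySymmetroidMatrixDescartes.TropicalCensus
open Summit.ValiantsHypothesis.ValiantsHypothesis.Theses.KPlusLogSqLaw (TropicalB)
open scoped BigOperators
open Finset

/-! ## 3. Corollaries of the `B`-uniform boundary vertex law -/

section Uniform

open scoped Classical in
/-- **`K`-FREE QUASI-POLYNOMIAL CAP FOR STATIC DESIGNS** from the uniform law: every static design of format `(2^L, K)` has at most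
`C·(2^L+1)^(3cL)` dominant terms. [this cell] -/
theorem card_dominant_static_le_of_uniform {C c : ℕ}
    (hU : ∀ (B n K' : ℕ) (π ρ : Fin B → Equiv.Perm (Fin n)) (lab : (Fin B → Bool) → Fin K') (d : Fin K' → ℕ)
      (v ε : Fin n → Fin n → Fin K' → ℤ), IsBoundaryDesign π ρ lab ε →
      (univ.filter fun q : Equiv.Perm (Fin n) × (Fin n → Fin K') => ∃ t : ℤ, IsDominant d v ε t q).card ≤ C * (n + 1) ^ (c * B))
    (L K : ℕ) (d : Fin K → ℕ) (v ε : Fin (2 ^ L) → Fin (2 ^ L) → Fin K → ℤ) (hstat : IsStatic ε) :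
    (univ.filter fun q : Equiv.Perm (Fin (2 ^ L)) × (Fin (2 ^ L) → Fin K) => ∃ t : ℤ, IsDominant d v ε t q).card ≤
      C * (2 ^ L + 1) ^ (c * (3 * L)) := by
  obtain ⟨π, ρ, hcode⟩ := exists_injective_code L
  obtain ⟨lab, d', v', ε', hbd, -, hle⟩ := card_dominant_le_of_code π ρ hcode d v ε hstat
  exact hle.trans (hU _ _ _ π ρ lab d' v' ε' hbd)

open scoped Classical in
/-- the static census row at size `2^L` from the uniform law. [this cell] -/
theorem tropRootLawAtStatic_pow_of_uniform {C c : ℕ}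
    (hU : ∀ (B n K' : ℕ) (π ρ : Fin B → Equiv.Perm (Fin n)) (lab : (Fin B → Bool) → Fin K') (d : Fin K' → ℕ)
      (v ε : Fin n → Fin n → Fin K' → ℤ), IsBoundaryDesign π ρ lab ε →
      (univ.filter fun q : Equiv.Perm (Fin n) × (Fin n → Fin K') => ∃ t : ℤ, IsDominant d v ε t q).card ≤ C * (n + 1) ^ (c * B))
    (L K : ℕ) : TropRootLawAtStatic (2 ^ L) K (C * (2 ^ L + 1) ^ (c * (3 * L)) - 1) := by
  classical
  intro d v ε n θ p _ hstat hθ hdom halt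
  have h1 := succ_le_card_dominant d v ε θ p hθ hdom (ne_succ_of_alternating ε p halt)
  have h2 := card_dominant_static_le_of_uniform hU L K d v ε hstat
  omega

open scoped Classical in
/-- the static census row at every size from the uniform law (`L = ⌊log₂ M⌋ + 1`, size padding). [this cell] -/
theorem tropRootLawAtStatic_of_uniform {C c : ℕ}
    (hU : ∀ (B n K' : ℕ) (π ρ : Fin B → Equiv.Perm (Fin n)) (lab : (Fin B → Bool) → Fin K') (d : Fin K' → ℕ)
      (v ε : Fin n → Fin n → Fin K' → ℤ), IsBoundaryDesign π ρ lab ε →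
      (univ.filter fun q : Equiv.Perm (Fin n) × (Fin n → Fin K') => ∃ t : ℤ, IsDominant d v ε t q).card ≤ C * (n + 1) ^ (c * B))
    (M K : ℕ) :
    TropRootLawAtStatic M K (C * (2 ^ (Nat.log 2 M + 1) + 1) ^ (c * (3 * (Nat.log 2 M + 1))) - 1) :=
  tropRootLawAtStatic_of_le_size (Nat.lt_pow_succ_log_self one_lt_two M).le (tropRootLawAtStatic_pow_of_uniform hU _ K)

open scoped Classical in
/-- the general census row from the uniform law (static ports at size `m·K`). [this cell] -/
theorem tropRootLawAt_of_uniform {C c : ℕ}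
    (hU : ∀ (B n K' : ℕ) (π ρ : Fin B → Equiv.Perm (Fin n)) (lab : (Fin B → Bool) → Fin K') (d : Fin K' → ℕ)
      (v ε : Fin n → Fin n → Fin K' → ℤ), IsBoundaryDesign π ρ lab ε →
      (univ.filter fun q : Equiv.Perm (Fin n) × (Fin n → Fin K') => ∃ t : ℤ, IsDominant d v ε t q).card ≤ C * (n + 1) ^ (c * B))
    (m K : ℕ) :
    TropRootLawAt m K (C * (2 ^ (Nat.log 2 (m * K) + 1) + 1) ^ (c * (3 * (Nat.log 2 (m * K) + 1))) - 1) :=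
  tropRootLawAt_of_static_ports_le le_rfl (tropRootLawAtStatic_of_uniform hU (m * K) K)

/-- exponent arithmetic: `C·(2^(ℓ+1) + 1)^(c·3(ℓ+1)) ≤ 2^(C + 3c(ℓ+1)(ℓ+2))`. [folklore] -/
theorem budget_le_two_pow (C c ℓ : ℕ) :
    C * (2 ^ (ℓ + 1) + 1) ^ (c * (3 * (ℓ + 1))) ≤ 2 ^ (C + 3 * c * ((ℓ + 1) * (ℓ + 2))) := by
  have h1 : 2 ^ (ℓ + 1) + 1 ≤ 2 ^ (ℓ + 2) := by
    have : 1 ≤ 2 ^ (ℓ + 1) := Nat.one_le_two_pow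
    calc 2 ^ (ℓ + 1) + 1 ≤ 2 ^ (ℓ + 1) + 2 ^ (ℓ + 1) := by omega
      _ = 2 ^ (ℓ + 2) := by ring
  have h2 : (2 ^ (ℓ + 1) + 1) ^ (c * (3 * (ℓ + 1))) ≤ 2 ^ (3 * c * ((ℓ + 1) * (ℓ + 2))) :=
    calc (2 ^ (ℓ + 1) + 1) ^ (c * (3 * (ℓ + 1))) ≤ (2 ^ (ℓ + 2)) ^ (c * (3 * (ℓ + 1))) := Nat.pow_le_pow_left h1 _
      _ = 2 ^ (3 * c * ((ℓ + 1) * (ℓ + 2))) := by rw [← pow_mul]; ring_nf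
  calc C * (2 ^ (ℓ + 1) + 1) ^ (c * (3 * (ℓ + 1))) ≤ 2 ^ C * 2 ^ (3 * c * ((ℓ + 1) * (ℓ + 2))) :=
        Nat.mul_le_mul Nat.lt_two_pow_self.le h2
    _ = 2 ^ (C + 3 * c * ((ℓ + 1) * (ℓ + 2))) := by rw [← pow_add]

/-- exponent arithmetic: `(ℓ+1)(ℓ+2) ≤ (3A+30)(K + ⌊log₂ m⌋²)` for `ℓ = ⌊log₂(mK)⌋`, `K ≥ 1`, `A` the constant of
`exists_logsq_le_add`. [folklore] -/
theorem logprod_le (A : ℕ) (hA : ∀ x : ℕ, Nat.log 2 x ^ 2 ≤ x + A) (m K : ℕ) (hK : 1 ≤ K) :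
    (Nat.log 2 (m * K) + 1) * (Nat.log 2 (m * K) + 2) ≤ (3 * A + 30) * (K + Nat.log 2 m ^ 2) := by
  set x := Nat.log 2 m with hx
  set y := Nat.log 2 K with hy
  set ℓ := Nat.log 2 (m * K) with hℓ
  have h1 : ℓ ≤ x + y + 1 := by have := log_two_mul_lt m K; omega
  have h2 : (ℓ + 1) * (ℓ + 2) ≤ (x + y + 3) ^ 2 := by
    have e1 : ℓ + 1 ≤ x + y + 3 := by omega
    have e2 : ℓ + 2 ≤ x + y + 3 := by omega
    calc (ℓ + 1) * (ℓ + 2) ≤ (x + y + 3) * (x + y + 3) := Nat.mul_le_mul e1 e2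
      _ = (x + y + 3) ^ 2 := (pow_two _).symm
  have h3 : (x + y + 3) ^ 2 ≤ 3 * (x ^ 2 + y ^ 2 + 9) := by
    zify
    nlinarith [sq_nonneg ((x : ℤ) - y), sq_nonneg ((x : ℤ) - 3), sq_nonneg ((y : ℤ) - 3)]
  have h4 : y ^ 2 ≤ K + A := hA K
  have h6 : A ≤ A * K := Nat.le_mul_of_pos_right A hK
  have h7 : 0 ≤ A * x ^ 2 := Nat.zero_le _
  calc (ℓ + 1) * (ℓ + 2) ≤ 3 * (x ^ 2 + y ^ 2 + 9) := h2.trans h3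
    _ ≤ 3 * x ^ 2 + 3 * (K + A) + 27 := by omega
    _ ≤ (3 * A + 30) * (K + x ^ 2) := by nlinarith [h6, h7, hK]

open scoped Classical in
/-- **THE `B`-UNIFORM LINEAR-EXPONENT BOUNDARY VERTEX LAW IMPLIES `TropicalB`.**  If one pair of constants `(C, c)` bounds the number
of dominant terms of every boundary-type design with `B` boundaries on `m` nodes by `C·(m+1)^(c·B)`, for ALL `B` (for each fixed `B`
this is `BoundaryVertexLaw B (c·B)` of p447010, here with a `B`-independent constant), then the crux `TropicalB` holds.  NOT a claim of
the uniform law — which by `card_dominant_static_le_of_uniform` is at least a `K`-free quasi-polynomial cap on all static designs. [this cell] -/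
theorem tropicalB_of_uniformBoundaryVertexLaw
    (hU : ∃ C c : ℕ, ∀ (B n K' : ℕ) (π ρ : Fin B → Equiv.Perm (Fin n)) (lab : (Fin B → Bool) → Fin K') (d : Fin K' → ℕ)
      (v ε : Fin n → Fin n → Fin K' → ℤ), IsBoundaryDesign π ρ lab ε →
      (Finset.univ.filter fun q : Equiv.Perm (Fin n) × (Fin n → Fin K') =>
        ∃ t : ℤ, IsDominant d v ε t q).card ≤ C * (n + 1) ^ (c * B)) :
    TropicalB := by
  classical
  obtain ⟨C, c, hU⟩ := hU
  obtain ⟨A, hA⟩ := exists_logsq_le_add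
  refine ⟨C + 3 * c * (3 * A + 30), fun m K => ?_⟩
  show TropRootLawAt m K (2 ^ ((C + 3 * c * (3 * A + 30)) * (K + Nat.log 2 m ^ 2)))
  rcases Nat.eq_zero_or_pos K with rfl | hK
  · exact tropRootLawAt_zero m _
  have hrow := tropRootLawAt_of_uniform hU m K
  refine tropRootLawAt_mono ?_ hrow
  have e3 : 1 ≤ K + Nat.log 2 m ^ 2 := le_trans hK (Nat.le_add_right K _)
  calc C * (2 ^ (Nat.log 2 (m * K) + 1) + 1) ^ (c * (3 * (Nat.log 2 (m * K) + 1))) - 1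
      ≤ C * (2 ^ (Nat.log 2 (m * K) + 1) + 1) ^ (c * (3 * (Nat.log 2 (m * K) + 1))) := Nat.sub_le _ _
    _ ≤ 2 ^ (C + 3 * c * ((Nat.log 2 (m * K) + 1) * (Nat.log 2 (m * K) + 2))) := budget_le_two_pow C c _
    _ ≤ 2 ^ ((C + 3 * c * (3 * A + 30)) * (K + Nat.log 2 m ^ 2)) := by
        refine Nat.pow_le_pow_right (by norm_num) ?_
        have h := logprod_le A hA m K hK
        calc C + 3 * c * ((Nat.log 2 (m * K) + 1) * (Nat.log 2 (m * K) + 2))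
            ≤ C * (K + Nat.log 2 m ^ 2) + 3 * c * ((3 * A + 30) * (K + Nat.log 2 m ^ 2)) :=
              Nat.add_le_add (Nat.le_mul_of_pos_right _ e3) (Nat.mul_le_mul_left _ h)
          _ = (C + 3 * c * (3 * A + 30)) * (K + Nat.log 2 m ^ 2) := by ring

end Uniform

end BoundarySector

end Summit.ValiantsHypothesis.ValiantsHypothesis.Theorems.KPlusLogSqLaw
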